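import Summits.HodgeConjecture.HodgeConjecture.Theorems.HeckePrymWeilWeilTwelvefoldsSqrtMinus7IsotypicDescent
import Summits.HodgeConjecture.HodgeConjecture.Theorems.HeckePrymWeilHeckePrymAnchorsSurfaceProductStep
import HarnessLib

/-!
# Crux `WeilTwelvefoldsSqrtMinus7` (stmt-HodgeConjecture-1261), line `isotypic-unimodular-saturation` — stub `stub_weilWitnessStep`

**The Weil WITNESS product step** (C. Schoen, Compositio Math. 114 (1998), §10; E. Markman,
arXiv:2509.23403 §11.5 Step 2): for a complex abelian `2k`-fold `(A, φ)` carrying a non-zero rational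
`(k,k)`-class of its typed Weil plane `Eig((𝟙+φ)^*, (1+i√7)^{2k}) ⊔ Eig((𝟙+φ)^*, (1-i√7)^{2k})` and a
complex abelian surface `(B, φ_B)` carrying eigenvectors `b± ∈ Eig((𝟙+φ_B)^*, (1±i√7)²)`, both non-zero,
with `b₊ + b₋` rational of type `(1,1)`, the product `A × B` carries a non-zero rational `(k+1,k+1)`-class
of the typed Weil plane of `(A × B, φ × φ_B)`: the Weil projector `Q = q(T)P` of
`P = pr_A^* c ⌣ pr_B^*(b₊ + b₋)`, `T = (𝟙 + φ × φ_B)^*` (the projector of the landed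
`AmnesicSecantSheaves.eigencomponents_mem_algebraicClasses`, `12 ↦ 2k`). Künneth for Hodge types is the
tree's `AmnesicSecantSheaves.stub_hodgeTypeExterior` fed by de Rham's theorem
`Literature.NumberTheory.Transcendental.exists_deRhamIsoFamily_holds`; Künneth non-vanishing is
`HeckePrymWeilLine.sps_cupProduct_map_fst_map_snd_ne_zero_prod`. No named fact is taken.
-/

noncomputable section

set_option linter.dupNamespace false

open CategoryTheory
open Literature.AlgebraicGeometry Literature.AlgebraicGeometry.Motives
  Literature.AlgebraicGeometry.HodgeTheory Literature.AlgebraicTopology.SingularHomology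
open Summit.HodgeConjecture.HodgeConjecture.Theorems.HeckePrymWeilLine
  (sps_cupProduct_map_fst_map_snd_ne_zero_prod sps_isSmoothProjective_of_dim_eq)

namespace Summit.HodgeConjecture.HodgeConjecture.Theorems.WeilTwelvefoldsSqrtMinus7.IsotypicUnimodularSaturation

/-- The sum of a non-zero `μ`-eigenvector and a `ν`-eigenvector of the same operator, `μ ≠ ν`, is
non-zero: eigenspaces of distinct eigenvalues are disjoint (`Module.End.eigenspaces_iSupIndep`).
[cite: Schoen1998HodgeWeilAddendum, §10 (proof of the Proposition)] -/
theorem wws_add_ne_zero_of_mem_eigenspaces {V : Type*} [AddCommGroup V] [Module ℂ V]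
    (T : Module.End ℂ V) {μ ν : ℂ} (hne : μ ≠ ν) {x y : V} (hx : x ∈ Module.End.eigenspace T μ)
    (hy : y ∈ Module.End.eigenspace T ν) (hx0 : x ≠ 0) : x + y ≠ 0 := by
  intro h
  have hxy : x = -y := eq_neg_of_add_eq_zero_left h
  have hx' : x ∈ Module.End.eigenspace T ν := by
    rw [hxy]
    exact Submodule.neg_mem _ hy
  have hdis : Disjoint (Module.End.eigenspace T μ) (Module.End.eigenspace T ν) :=
    (Module.End.eigenspaces_iSupIndep T).pairwiseDisjoint hne
  exact hx0 ((Submodule.disjoint_def.1 hdis) x hx hx')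

/-- **Stub `stub_weilWitnessStep` (Stub 1, r2) of line `isotypic-unimodular-saturation`, crux
`WeilTwelvefoldsSqrtMinus7` (stmt-HodgeConjecture-1261): the Weil WITNESS product step.** Let `(A, φ)`
be a complex abelian `2k`-fold (`k ≥ 1`) and `(B, φ_B)` a complex abelian surface carrying
`b₊ ∈ Eig((𝟙+φ_B)^*, (1+i√7)²)`, `b₋ ∈ Eig((𝟙+φ_B)^*, (1-i√7)²)`, both non-zero, with `b₊ + b₋` rational
of Hodge type `(1,1)`. If `A` carries a non-zero rational `(k,k)`-class `c` of its typed Weil plane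
`Eig((𝟙+φ)^*, (1+i√7)^{2k}) ⊔ Eig((𝟙+φ)^*, (1-i√7)^{2k})`, then `A × B` carries a non-zero rational
`(k+1,k+1)`-class of the typed Weil plane of `(A × B, φ × φ_B)`. PROOF (Schoen's Weil projector): write
`c = c₊ + c₋`, `P = pr_A^*c ⌣ pr_B^*(b₊+b₋) = P₊₊ + P₋₋ + P₊₋ + P₋₊` with `T = (𝟙 + φ×φ_B)^*` acting
factorwise (eigenvalues `λ±^{2k}λ±'²`, `λ± = 1 ± i√7`); `Q = T²P - (β+β̄)TP + ββ̄P` (`β = λ₊^{2k}λ₋²`,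
`β + β̄ ∈ ℤ`, `ββ̄ = 8^{2k+2}`) equals `a₊P₊₊ + a₋P₋₋` with `a± ≠ 0` (`weilProjector_eq`,
`Negative.one_add_I_sqrt7_pow_ne`), is rational (`IsRationalClass.map/cup/add/smul`), of Hodge type
`(k+1,k+1)` (Künneth for Hodge types `AmnesicSecantSheaves.stub_hodgeTypeExterior` +
`exists_deRhamIsoFamily_holds`, and `HodgeModel.pullback_map_mem_hodgePQ_of_endomorphism`), lies in the
typed plane, and is non-zero by Künneth non-vanishing (`sps_cupProduct_map_fst_map_snd_ne_zero_prod`: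
`c₊ ≠ 0 ⇒ P₊₊ ≠ 0`, else `c₋ ≠ 0 ⇒ P₋₋ ≠ 0`; eigenvectors of distinct eigenvalues are independent).
[cite: Schoen1998HodgeWeilAddendum, §10 (proof of the Proposition)] [cite: Markman2025SurveySecant, §11.5 Step 2] -/
theorem stub_weilWitnessStep :
    ∀ (k : ℕ) (A B : AbelianVariety ℂ) (φ : A ⟶ A) (φB : B ⟶ B), 1 ≤ k → A.dim = 2 * k → B.dim = 2 →
    ∀ (bp bm : complexBetti B.X 2),
      bp ∈ Module.End.eigenspace (complexBetti.map (𝟙 B + φB).hom.hom.hom 2).hom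
            ((1 + Complex.I * (Real.sqrt (7 : ℝ) : ℂ)) ^ 2) →
      bm ∈ Module.End.eigenspace (complexBetti.map (𝟙 B + φB).hom.hom.hom 2).hom
            ((1 - Complex.I * (Real.sqrt (7 : ℝ) : ℂ)) ^ 2) →
      IsRationalClass (bp + bm) → IsOfHodgeType 2 B.X 2 1 1 (bp + bm) → bp ≠ 0 → bm ≠ 0 →
      (∃ c : complexBetti A.X (2 * k), c ≠ 0 ∧ IsRationalClass c ∧
        IsOfHodgeType (2 * k) A.X (2 * k) k k c ∧
        c ∈ Module.End.eigenspace (complexBetti.map (𝟙 A + φ).hom.hom.hom (2 * k)).hom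
              ((1 + Complex.I * (Real.sqrt (7 : ℝ) : ℂ)) ^ (2 * k)) ⊔
            Module.End.eigenspace (complexBetti.map (𝟙 A + φ).hom.hom.hom (2 * k)).hom
              ((1 - Complex.I * (Real.sqrt (7 : ℝ) : ℂ)) ^ (2 * k))) →
      ∃ c' : complexBetti (A.prod B).X (2 * (k + 1)), c' ≠ 0 ∧ IsRationalClass c' ∧
        IsOfHodgeType (2 * (k + 1)) (A.prod B).X (2 * (k + 1)) (k + 1) (k + 1) c' ∧
        c' ∈ Module.End.eigenspace (complexBetti.map (𝟙 (A.prod B) +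
                AbelianVariety.prodLift (AbelianVariety.fst A B ≫ φ) (AbelianVariety.snd A B ≫ φB)).hom.hom.hom
                (2 * (k + 1))).hom ((1 + Complex.I * (Real.sqrt (7 : ℝ) : ℂ)) ^ (2 * (k + 1))) ⊔
            Module.End.eigenspace (complexBetti.map (𝟙 (A.prod B) +
                AbelianVariety.prodLift (AbelianVariety.fst A B ≫ φ) (AbelianVariety.snd A B ≫ φB)).hom.hom.hom
                (2 * (k + 1))).hom ((1 - Complex.I * (Real.sqrt (7 : ℝ) : ℂ)) ^ (2 * (k + 1))) := by
  intro k A B φ φB hk hA hB bp bm hbp hbm hbr hbH hbp0 hbm0 hc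
  obtain ⟨c, hc0, hcr, hcH, hcW⟩ := hc
  obtain ⟨cp, hcp, cm, hcm, rfl⟩ := Submodule.mem_sup.1 hcW
  -- degree bookkeeping and smooth projectivity
  have hdeg : 2 * k + 2 = 2 * (k + 1) := by ring
  have hA' : IsSmoothProjective (2 * k) A.X := sps_isSmoothProjective_of_dim_eq A hA
  have hB' : IsSmoothProjective 2 B.X := sps_isSmoothProjective_of_dim_eq B hB
  have hBX : IsSmoothProjective (2 * k + 2) (A.prod B).X :=
    sps_isSmoothProjective_of_dim_eq (A.prod B) (by rw [AbelianVariety.dim_prod, hA, hB])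
  -- the two Weil characters at the test endomorphism `𝟙 + φ`
  set sp : ℂ := 1 + Complex.I * (Real.sqrt (7 : ℝ) : ℂ) with hsp
  set sm : ℂ := 1 - Complex.I * (Real.sqrt (7 : ℝ) : ℂ) with hsm
  have hspm : ∀ n : ℕ, 1 ≤ n → sp ^ n ≠ sm ^ n := fun n hn ↦ Negative.one_add_I_sqrt7_pow_ne n hn
  have hsp0 : sp ≠ 0 := Negative.one_add_I_sqrt7_ne_zero
  have hsm0 : sm ≠ 0 := Negative.one_sub_I_sqrt7_ne_zero
  -- `ψ = φ × φ_B`, `g = 𝟙 + ψ`, `T = g^*` on `H^{2k+2}((A × B)(ℂ))`, computed FACTORWISE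
  set g : A.prod B ⟶ A.prod B := 𝟙 (A.prod B) +
    AbelianVariety.prodLift (AbelianVariety.fst A B ≫ φ) (AbelianVariety.snd A B ≫ φB) with hg
  have hg₁ : g ≫ AbelianVariety.fst A B = AbelianVariety.fst A B ≫ (𝟙 A + φ) := by
    simp [hg, Preadditive.add_comp, Preadditive.comp_add]
  have hg₂ : g ≫ AbelianVariety.snd A B = AbelianVariety.snd A B ≫ (𝟙 B + φB) := by
    simp [hg, Preadditive.add_comp, Preadditive.comp_add]
  set T : complexBetti (A.prod B).X (2 * (k + 1)) →ₗ[ℂ] complexBetti (A.prod B).X (2 * (k + 1)) :=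
    (complexBetti.map g.hom.hom.hom (2 * (k + 1))).hom with hT
  have hTapp : ∀ u : complexBetti (A.prod B).X (2 * (k + 1)), T u =
      singularCohomology.map ℂ ℂ (Motives.AlgPoints.mapContinuous (L := ℂ) g.hom.hom.hom) (2 * (k + 1)) u :=
    fun _ ↦ rfl
  -- eigen-equations: of the four factors, and of the four pieces of `P = pr_A^*(c₊+c₋) ∪ pr_B^*(b₊+b₋)`
  have hcp' : complexBetti.map (𝟙 A + φ).hom.hom.hom (2 * k) cp = sp ^ (2 * k) • cp :=
    Module.End.mem_eigenspace_iff.1 hcp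
  have hcm' : complexBetti.map (𝟙 A + φ).hom.hom.hom (2 * k) cm = sm ^ (2 * k) • cm :=
    Module.End.mem_eigenspace_iff.1 hcm
  have hbp' : complexBetti.map (𝟙 B + φB).hom.hom.hom 2 bp = sp ^ 2 • bp := Module.End.mem_eigenspace_iff.1 hbp
  have hbm' : complexBetti.map (𝟙 B + φB).hom.hom.hom 2 bm = sm ^ 2 • bm := Module.End.mem_eigenspace_iff.1 hbm
  have tt : ∀ (x : complexBetti A.X (2 * k)) (y : complexBetti B.X 2) (a e : ℂ),
      complexBetti.map (𝟙 A + φ).hom.hom.hom (2 * k) x = a • x →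
      complexBetti.map (𝟙 B + φB).hom.hom.hom 2 y = e • y →
      T (cupProduct hdeg (complexBetti.map (AbelianVariety.fst A B).hom.hom.hom (2 * k) x)
          (complexBetti.map (AbelianVariety.snd A B).hom.hom.hom 2 y)) =
        (a * e) • cupProduct hdeg (complexBetti.map (AbelianVariety.fst A B).hom.hom.hom (2 * k) x)
          (complexBetti.map (AbelianVariety.snd A B).hom.hom.hom 2 y) := by
    intro x y a e hx hy
    rw [hTapp, cupProduct_map, AmnesicSecantSheaves.map_map_eq_of_comp_eq hg₁,
      AmnesicSecantSheaves.map_map_eq_of_comp_eq hg₂, hx, hy]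
    simp only [map_smul, LinearMap.smul_apply, smul_smul, mul_comm]
  set P : complexBetti (A.prod B).X (2 * (k + 1)) := cupProduct hdeg
    (complexBetti.map (AbelianVariety.fst A B).hom.hom.hom (2 * k) (cp + cm))
    (complexBetti.map (AbelianVariety.snd A B).hom.hom.hom 2 (bp + bm)) with hPdef
  set P₁ : complexBetti (A.prod B).X (2 * (k + 1)) := cupProduct hdeg
    (complexBetti.map (AbelianVariety.fst A B).hom.hom.hom (2 * k) cp)
    (complexBetti.map (AbelianVariety.snd A B).hom.hom.hom 2 bp) with hP₁
  set P₂ : complexBetti (A.prod B).X (2 * (k + 1)) := cupProduct hdeg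
    (complexBetti.map (AbelianVariety.fst A B).hom.hom.hom (2 * k) cm)
    (complexBetti.map (AbelianVariety.snd A B).hom.hom.hom 2 bm) with hP₂
  have hP : P = P₁ + P₂ +
      cupProduct hdeg (complexBetti.map (AbelianVariety.fst A B).hom.hom.hom (2 * k) cp)
        (complexBetti.map (AbelianVariety.snd A B).hom.hom.hom 2 bm) +
      cupProduct hdeg (complexBetti.map (AbelianVariety.fst A B).hom.hom.hom (2 * k) cm)
        (complexBetti.map (AbelianVariety.snd A B).hom.hom.hom 2 bp) := by
    simp only [hPdef, hP₁, hP₂, map_add, LinearMap.add_apply]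
    abel
  have t₁ : T P₁ = (sp ^ (2 * k) * sp ^ 2) • P₁ := tt _ _ _ _ hcp' hbp'
  have t₂ : T P₂ = (sm ^ (2 * k) * sm ^ 2) • P₂ := tt _ _ _ _ hcm' hbm'
  -- `P₊₊`, `P₋₋` and their combinations lie in the typed Weil plane of `A × B` (`λ±^{2k} λ±² = λ±^{2k+2}`)
  have hP₁E : P₁ ∈ Module.End.eigenspace T (sp ^ (2 * (k + 1))) := by
    rw [Module.End.mem_eigenspace_iff, t₁, ← pow_add, hdeg]
  have hP₂E : P₂ ∈ Module.End.eigenspace T (sm ^ (2 * (k + 1))) := by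
    rw [Module.End.mem_eigenspace_iff, t₂, ← pow_add, hdeg]
  have hW : ∀ a e : ℂ, a • P₁ + e • P₂ ∈
      Module.End.eigenspace T (sp ^ (2 * (k + 1))) ⊔ Module.End.eigenspace T (sm ^ (2 * (k + 1))) :=
    fun a e ↦ Submodule.add_mem _ (Submodule.mem_sup_left (Submodule.smul_mem _ _ hP₁E))
      (Submodule.mem_sup_right (Submodule.smul_mem _ _ hP₂E))
  -- the projector `Q = q(T) P`, `q(X) = (X - β)(X - β')`, `β, β'` the two mixed eigenvalues
  set α : ℂ := sp ^ (2 * k) * sp ^ 2 with hα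
  set α' : ℂ := sm ^ (2 * k) * sm ^ 2 with hα'
  set β : ℂ := sp ^ (2 * k) * sm ^ 2 with hβ
  set β' : ℂ := sm ^ (2 * k) * sp ^ 2 with hβ'
  set Q : complexBetti (A.prod B).X (2 * (k + 1)) := T (T P) - (β + β') • T P + (β * β') • P with hQdef
  have hQ : Q = ((α - β) * (α - β')) • P₁ + ((α' - β) * (α' - β')) • P₂ :=
    weilProjector_eq T hP t₁ t₂ (tt _ _ _ _ hcp' hbm') (tt _ _ _ _ hcm' hbp')
  -- `Q` is rational: `P` is, `T` preserves rationality, `β + β' ∈ ℤ`, `ββ' = 8^{2k+2}`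
  have hPr : IsRationalClass P := (hcr.map _).cup _ (hbr.map _)
  have hTPr : IsRationalClass (T P) := by rw [hTapp]; exact hPr.map _
  have hTTPr : IsRationalClass (T (T P)) := by rw [hTapp]; exact hTPr.map _
  have hsum : sp + sm = ((2 : ℤ) : ℂ) := by rw [hsp, hsm]; push_cast; ring
  have hprod : sp * sm = ((8 : ℤ) : ℂ) := by
    rw [hsp, hsm]
    push_cast
    linear_combination (-(((Real.sqrt (7 : ℝ) : ℝ) : ℂ) * ((Real.sqrt (7 : ℝ) : ℝ) : ℂ))) * Complex.I_mul_I +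
      Negative.sqrt7_mul_sqrt7
  obtain ⟨zs, hzs⟩ : ∃ z : ℤ, (z : ℂ) = β + β' := exists_intCast_eq_pow_mul_pow_add hsum hprod (2 * k) 2
  obtain ⟨zt, hzt⟩ : ∃ z : ℤ, (z : ℂ) = β * β' :=
    ⟨8 ^ (2 * k + 2), by rw [Int.cast_pow, ← hprod, hβ, hβ']; ring⟩
  have hQr : IsRationalClass Q := by
    have e : Q = T (T P) + (((-zs : ℤ) : ℚ) : ℂ) • T P + (((zt : ℤ) : ℚ) : ℂ) • P := by
      rw [hQdef, Rat.cast_intCast, Rat.cast_intCast, Int.cast_neg, hzs, hzt, neg_smul, ← sub_eq_add_neg]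
    rw [e]
    exact (hTTPr.add (hTPr.smul _)).add (hPr.smul _)
  -- `Q` is of Hodge type `(k+1,k+1)`: `P` is (Künneth for Hodge types, de Rham's theorem), and the
  -- endomorphism `g` preserves the `(p,q)`-classes of the Hodge model `M` of `A × B` witnessing it
  obtain ⟨M, hM⟩ : IsOfHodgeType (2 * k + 2) (A.prod B).X (2 * (k + 1)) (k + 1) (k + 1) P :=
    AmnesicSecantSheaves.stub_hodgeTypeExterior
      (fun E _ _ _ => Literature.NumberTheory.Transcendental.exists_deRhamIsoFamily_holds E)
      A B (2 * k) 2 hA hB (2 * k) 2 (2 * (k + 1)) hdeg k k 1 1 (cp + cm) (bp + bm) hcH hbH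
  have hstab : ∀ u : complexBetti (A.prod B).X (2 * (k + 1)),
      M.pullback (2 * (k + 1)) u ∈ M.hodgePQ (2 * (k + 1)) (k + 1) (k + 1) →
      M.pullback (2 * (k + 1)) (T u) ∈ M.hodgePQ (2 * (k + 1)) (k + 1) (k + 1) := fun u hu ↦ by
    rw [hTapp]
    exact M.pullback_map_mem_hodgePQ_of_endomorphism hBX g.hom.hom.hom hu
  have hMP : P ∈ (M.hodgePQ (2 * (k + 1)) (k + 1) (k + 1)).comap (M.pullback (2 * (k + 1))).hom := hM
  have hMQ : Q ∈ (M.hodgePQ (2 * (k + 1)) (k + 1) (k + 1)).comap (M.pullback (2 * (k + 1))).hom := by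
    rw [hQdef]
    exact Submodule.add_mem _ (Submodule.sub_mem _ (hstab _ (hstab _ hMP))
      (Submodule.smul_mem _ _ (hstab _ hMP))) (Submodule.smul_mem _ _ hMP)
  -- the coefficients `a± = (α± - β)(α± - β')` of `Q = a₊ P₊₊ + a₋ P₋₋` are non-zero
  have hap : (α - β) * (α - β') ≠ 0 := by
    refine mul_ne_zero ?_ ?_
    · rw [hα, hβ, ← mul_sub]
      exact mul_ne_zero (pow_ne_zero _ hsp0) (sub_ne_zero.mpr (hspm 2 (by norm_num)))
    · rw [hα, hβ', ← sub_mul]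
      exact mul_ne_zero (sub_ne_zero.mpr (hspm (2 * k) (by omega))) (pow_ne_zero _ hsp0)
  have ham : (α' - β) * (α' - β') ≠ 0 := by
    refine mul_ne_zero ?_ ?_
    · rw [hα', hβ, ← sub_mul]
      exact mul_ne_zero (sub_ne_zero.mpr (hspm (2 * k) (by omega)).symm) (pow_ne_zero _ hsm0)
    · rw [hα', hβ', ← mul_sub]
      exact mul_ne_zero (pow_ne_zero _ hsm0) (sub_ne_zero.mpr (hspm 2 (by norm_num)).symm)
  -- `Q ≠ 0`: Künneth non-vanishing of `P₊₊` (if `c₊ ≠ 0`) or of `P₋₋` (if `c₊ = 0`, so `c₋ ≠ 0`), and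
  -- eigenvectors of the distinct eigenvalues `λ₊^{2k+2} ≠ λ₋^{2k+2}` are independent
  have hne : sp ^ (2 * (k + 1)) ≠ sm ^ (2 * (k + 1)) := hspm _ (by omega)
  have hQ0 : Q ≠ 0 := by
    rw [hQ]
    by_cases hcp0 : cp = 0
    · have hcm0 : cm ≠ 0 := by
        rintro rfl
        exact hc0 (by rw [hcp0, add_zero])
      have hP₂0 : P₂ ≠ 0 := sps_cupProduct_map_fst_map_snd_ne_zero_prod hA' hB' hdeg hcm0 hbm0
      rw [add_comm (((α - β) * (α - β')) • P₁) (((α' - β) * (α' - β')) • P₂)]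
      exact wws_add_ne_zero_of_mem_eigenspaces T hne.symm (Submodule.smul_mem _ _ hP₂E)
        (Submodule.smul_mem _ _ hP₁E) (smul_ne_zero ham hP₂0)
    · have hP₁0 : P₁ ≠ 0 := sps_cupProduct_map_fst_map_snd_ne_zero_prod hA' hB' hdeg hcp0 hbp0
      exact wws_add_ne_zero_of_mem_eigenspaces T hne (Submodule.smul_mem _ _ hP₁E)
        (Submodule.smul_mem _ _ hP₂E) (smul_ne_zero hap hP₁0)
  exact ⟨Q, hQ0, hQr, ⟨M, hMQ⟩, hQ ▸ hW _ _⟩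

end Summit.HodgeConjecture.HodgeConjecture.Theorems.WeilTwelvefoldsSqrtMinus7.IsotypicUnimodularSaturation

end
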